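import Summits.HodgeConjecture.HodgeConjecture.Theorems.R90S4InnerSimilFixesClass   -- ★ (this seat, p861508) `comap_cmDatumLocalCongr_eq_of_eq_norm_mul`, `comap_cmDatumLocalCongr_eq_self_of_coe`
import Literature.NumberTheory.Automorphic.QuadraticLocalNormGroupNonsplit           -- ★ `exists_norm_mul_iff_norm_tests_iff` (index two at a non-split place), `exists_ne_zero_toLocalRing_eq_of_conjLocal_eq`; brings ★ `exists_isUnit_toLocalRing_eq_mul_conjLocal_of_not_subsingleton` (split places)
import Literature.NumberTheory.Automorphic.IrreducibleClassesBoxChar                 -- ★ `IrrClass.boxChar`, `IrrClass.boxChar_injective`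
import Literature.NumberTheory.Automorphic.HeckeEigencharacterPackage                -- ★ `IrrClass.IsAdmissible` (token of the socket)
import HarnessLib

/-!
# R90-TF · S4 (Rogawski Ch. 13.1–2) — socket S4#B4 `stub_R90_S4_H_card`: an L-packet of `H_v = U(Φ₂)_v × U(Φ₁)_v` has ONE OR TWO members

Cell `hodgecm-mathlib`, crux H413 (`stmt-HodgeConjecture-24833`, lane `--supports`), route of record `HCCMUnconditional` (no route
verbs; count-neutral).  Programme R90-TF (brief `director/R90-BRIEF.v2.md`), section S4 = Ch. 13.1–2 (base `R90-C131`); seat R90-C131-p03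
(g0), dealt BY NAME «p03 → S4#B4 `stub_R90_S4_H_card : IsRogPacketH L v S → S.card = 1 ∨ S.card = 2`» (:347 of the BY-WRITE file
`Cruxes/H413/Lines/R90_S4_HPacketsU2B.lean`, ED. 1 251612dbcc286c69; DEAL-S4-WAVE1, K2E2-plan (g6) ∕ DEAL-S4B-WAVE1, R90-C131-typ2 (g0);
AUDIT S4#B4 CLEAN, R90-C131-audit1 (g0)).  THEOREMS ONLY (no `def`, no instance, no notation, no named fact, no `sorry`); imports ★ only —
in particular NOT the by-write `Cruxes/…` file: the closer §4 is stated in NAME-SHAPE, i.e. with the bodies of that file's `def`s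
`HLoc ∕ U2Loc ∕ U1Loc ∕ Φ₂Loc ∕ IsRogPacketH ∕ IsRogPacketU2 ∕ IsU2SimilConj` COPIED BYTE FOR BYTE, so that the socket is closed by
`fun L _ _ _ v S hS => card_eq_one_or_two_of_isRogPacketH L v S hS` (definitional unfolding; by-import probe of the deal-desk).
HONEST LABEL: HC_CM is proved only modulo the 7 printed citations (2 remaining named inputs: hLiu418 = stmt-HodgeConjecture-24832,
h413 = stmt-HodgeConjecture-24833) until rung 0 closes; this file is unconditional local algebra + representation theory (no WAITS).

PRINT.  «An L-packet on `G` [= `U(2)`] is, by definition, a `PGL₂(F)`-orbit in `E(G)`» and Prop. 11.1.1 (a): all packets have one or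
two elements [Rogawski1990, §11.1 p. 161]; «`ρ = ρ₁ ⊗ χ`, where `ρ₁` is a representation of `U(2)` and `χ` is a character of `U(1)`»
[§12.1 p. 172].  MATHEMATICS.  The `PGL₂(F) = G_ad(F)`-action is realised (the by-write file's DESIGN) by local similitudes
`T ∈ GL₂(L ⊗ L⁺_v)`, `ᵗσ(T) Φ₂ T = a Φ₂`; the orbit map `T ↦ σ ∘ Ad(T)` factors through the MULTIPLIER CLASS `a mod {σ(z) z}` (★
`comap_cmDatumLocalCongr_eq_of_eq_norm_mul`, this seat's F1: similitudes in the same norm class differ by `Ad(u)`, `u ∈ U(Φ₂)_v`, and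
`π ∘ Ad(u) ≅ π`), the multiplier is `σ`-fixed (★ `conjLocal_eq_self_of_formCongr_eq_smul_antidiag`), and the `σ`-fixed units of
`E_v = L ⊗ L⁺_v` modulo norms `σ(z) z` have AT MOST TWO classes: exactly two at a non-split `v` (★ `index_norms_eq_two_of_nonsplit` —
O'Meara 63:13a proved in the tree WITHOUT class field theory, dyadic places included — read through ★ `exists_norm_mul_iff_norm_tests_iff`),
one at a split `v` (★ `exists_isUnit_toLocalRing_eq_mul_conjLocal_of_not_subsingleton`).  Hence no three similitude-conjugates of a class
are pairwise distinct, the orbit finset has `≤ 2` members, and `≥ 1` (it contains its generator, `T = 1`); `⊠ χ₁` is injective.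

CONTENTS.
* §1 `exists_eq_norm_mul_of_three` — «`|F_v^× ∕ N E_v^×| ≤ 2`» in `E_v`-currency: of three `σ`-fixed units two lie in the same norm class.
* §2 `exists_comap_eq_of_three` — of three similitude pull-backs `Irr(U(H)_v) → Irr(U(Φ_N)_v)` of one class (any `N ≠ 0`, `H` hermitian)
  two coincide.
* §3 `card_le_two_of_forall_mem_iff` ∕ `card_eq_one_or_two_of_forall_mem_iff` — a full similitude orbit in `Irr(U(Φ_N)(L⁺_v))`, as a
  finset, has one or two members (Prop. 11.1.1 (a) for `N = 2`).
* §4 `card_eq_one_or_two_of_isRogPacketH` — THE SOCKET S4#B4 in NAME-SHAPE (`H_v`-packets `O ⊠ χ₁`, `Finset.card_map`).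
DEPENDENCY CUT (CENSUS-FIRST, LEAD #12 (2)): `card_of_⟨nothing⟩` — every upstream is ★ today; no `-- WAITS ON`.

## References
* [Rogawski1990] J. D. Rogawski, *Automorphic Representations of Unitary Groups in Three Variables*, Ann. of Math. Stud. 123 (1990):
  §11.1 p. 161, Prop. 11.1.1 (a); §12.1 pp. 171–172; Prop. 13.1.2 (a) p. 198; §3.5 Prop. 3.5.2 (a), Lemma 3.5.3 (a) pp. 28–29.
* [Omeara1963] O. T. O'Meara, *Introduction to Quadratic Forms* (1963), §63B Prop. 63:13a (the local norm index is `2`).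
* [BushnellHenniart2006] C. J. Bushnell, G. Henniart, *The Local Langlands Conjecture for GL(2)* (2006), §1.1, §9.1.
* [PlatonovRapinchuk1994] V. Platonov, A. Rapinchuk, *Algebraic Groups and Number Theory* (1994), §2.3.
-/

set_option autoImplicit false
-- the mandated namespace repeats `HodgeConjecture.HodgeConjecture`, as in every `Theorems/*.lean` of this sub-problem
set_option linter.dupNamespace false

noncomputable section

open NumberField IsDedekindDomain
open scoped Matrix MatrixGroups Classical

open Literature.NumberTheory.Automorphic Literature.NumberTheory.Automorphic.UnitaryGroup

namespace Summit.HodgeConjecture.HodgeConjecture.R90.S4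

variable (L : Type) [Field L] [NumberField L] [IsCMField L]

/-! ## §1 «`|F_v^× ∕ N E_v^×| ≤ 2`»: of three `σ`-fixed units of `L ⊗ L⁺_v`, two lie in the same norm class -/

/-- **Of three `σ`-fixed units of `E_v = L ⊗ L⁺_v`, two differ by a norm `σ(z) z`** (`z` a unit).  At a NON-SPLIT `v` (one place `w ∣ v`,
`w̄ = w`) this is the local norm index `[F_v^× : N E_w^×] = 2` (O'Meara 63:13a, ★ `index_norms_eq_two_of_nonsplit`, read through ★
`exists_norm_mul_iff_norm_tests_iff`: `a₃ ∈ N·a₂ ↔ (a₃ ∈ N·a₁ ↔ a₂ ∈ N·a₁)`); at a SPLIT `v` every `σ`-fixed unit is a norm (★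
`exists_isUnit_toLocalRing_eq_mul_conjLocal_of_not_subsingleton`), so already `a₂ ∈ N·a₁`.  The purely imaginary `δ = e − ē ≠ 0` needed by
the `E_v`-currency lemmas exists as `c ≠ 1`. [cite: Omeara1963, §63B Prop. 63:13a] [cite: Rogawski1990, §3.5 Prop. 3.5.2 (a) p. 29] -/
theorem exists_eq_norm_mul_of_three (v : HeightOneSpectrum (𝓞 ↥(maximalRealSubfield L))) {a₁ a₂ a₃ : LocalRing L v}
    (h₁ : conjLocal L (IsCMField.complexConj L) v a₁ = a₁) (hu₁ : IsUnit a₁)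
    (h₂ : conjLocal L (IsCMField.complexConj L) v a₂ = a₂) (hu₂ : IsUnit a₂)
    (h₃ : conjLocal L (IsCMField.complexConj L) v a₃ = a₃) (hu₃ : IsUnit a₃) :
    (∃ z : LocalRing L v, IsUnit z ∧ a₂ = conjLocal L (IsCMField.complexConj L) v z * z * a₁) ∨
    (∃ z : LocalRing L v, IsUnit z ∧ a₃ = conjLocal L (IsCMField.complexConj L) v z * z * a₁) ∨
    (∃ z : LocalRing L v, IsUnit z ∧ a₃ = conjLocal L (IsCMField.complexConj L) v z * z * a₂) := by
  set c := IsCMField.complexConj L with hcdef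
  set σ := conjLocal L c v with hσdef
  -- a purely imaginary `δ ≠ 0` (`c ≠ 1`)
  obtain ⟨e, he⟩ : ∃ e : L, c e ≠ e := by
    by_contra h
    exact IsCMField.complexConj_ne_one L (AlgEquiv.ext fun x => not_ne_iff.mp (not_exists.mp h x))
  have hcδ : c (e - c e) = -(e - c e) := by rw [map_sub, hcdef, IsCMField.complexConj_apply_apply, neg_sub]
  have hδ : e - c e ≠ 0 := fun h0 => he (sub_eq_zero.1 h0).symm
  obtain ⟨w⟩ : Nonempty (PlacesOver L v) := inferInstance
  by_cases hw : c • w.1 = w.1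
  · -- NON-SPLIT: index two
    have key := exists_norm_mul_iff_norm_tests_iff L v c hcδ hδ w hw (a := a₂) (a' := a₃) (g := a₁) h₂ hu₂ h₃ hu₃ h₁ hu₁
    by_cases h21 : ∃ z : LocalRing L v, IsUnit z ∧ a₂ = σ z * z * a₁
    · exact Or.inl h21
    by_cases h31 : ∃ z : LocalRing L v, IsUnit z ∧ a₃ = σ z * z * a₁
    · exact Or.inr (Or.inl h31)
    exact Or.inr (Or.inr (key.2 ⟨fun h => absurd h h31, fun h => absurd h h21⟩))
  · -- SPLIT: every `σ`-fixed unit is a norm, so `a₂ ∈ N · a₁`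
    refine Or.inl ?_
    have hv : ¬ Subsingleton (PlacesOver L v) := fun hs => PlacesOver.galInv_ne c w hw (Subsingleton.elim _ _)
    obtain ⟨a₁i, ha₁iu, h11⟩ : ∃ a₁i : LocalRing L v, IsUnit a₁i ∧ a₁ * a₁i = 1 :=
      ⟨(hu₁.unit⁻¹ : (LocalRing L v)ˣ), Units.isUnit _, hu₁.mul_val_inv⟩
    have hσa₁i : σ a₁i = a₁i := by
      have e1 : σ a₁i * a₁ = 1 := by rw [← h₁, ← map_mul, mul_comm, h11, map_one]
      calc σ a₁i = σ a₁i * (a₁ * a₁i) := by rw [h11, mul_one]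
        _ = a₁i := by rw [← mul_assoc, e1, one_mul]
    obtain ⟨p, hp0, hp⟩ := exists_ne_zero_toLocalRing_eq_of_conjLocal_eq L v c hcδ hδ (r := a₂ * a₁i)
      (by rw [map_mul, h₂, hσa₁i]) (hu₂.mul ha₁iu)
    obtain ⟨z, hz, hpz⟩ :=
      exists_isUnit_toLocalRing_eq_mul_conjLocal_of_not_subsingleton L c (IsCMField.complexConj_ne_one L) v hv hp0
    refine ⟨z, hz, ?_⟩
    calc a₂ = a₂ * a₁i * a₁ := by rw [mul_assoc, mul_comm a₁i, h11, mul_one]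
      _ = σ z * z * a₁ := by rw [← hp, hpz, mul_comm z]

/-! ## §2 Of three similitude pull-backs of one class, two coincide -/

/-- **Three local similitudes `ᵗσ(Tᵢ) · H_v · Tᵢ = aᵢ • (Φ_N)_v` pull a class back to AT MOST TWO classes**: for `H` hermitian, `N ≠ 0`
and `c ∈ Irr(U(H)(L⁺_v))`, two of the three `IrrClass.comap (Ad Tᵢ) c ∈ Irr(U(Φ_N)(L⁺_v))` coincide — the multipliers `aᵢ` are
`σ`-fixed (★ `conjLocal_eq_self_of_formCongr_eq_smul_antidiag`), two of them share a norm class (§1), and similitudes in the same norm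
class induce the same pull-back (★ `comap_cmDatumLocalCongr_eq_of_eq_norm_mul`). [cite: Rogawski1990, §11.1 p. 161, Prop. 11.1.1 (a)]
[cite: BushnellHenniart2006, §1.1] -/
theorem exists_comap_eq_of_three {N : ℕ} (hN : N ≠ 0) {H : Matrix (Fin N) (Fin N) L} (hH : (H.map (cmConjRingHom L))ᵀ = H)
    (v : HeightOneSpectrum (𝓞 ↥(maximalRealSubfield L))) (T₁ T₂ T₃ : GL (Fin N) (LocalRing L v)) {a₁ a₂ a₃ : LocalRing L v}
    (ha₁ : IsUnit a₁) (ha₂ : IsUnit a₂) (ha₃ : IsUnit a₃)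
    (h₁ : formCongr (conjLocal L (IsCMField.complexConj L) v) T₁ (H.map (algebraMap L (LocalRing L v))) =
      a₁ • (Matrix.of fun i j : Fin N => if i.val + j.val + 1 = N then (1 : L) else 0).map (algebraMap L (LocalRing L v)))
    (h₂ : formCongr (conjLocal L (IsCMField.complexConj L) v) T₂ (H.map (algebraMap L (LocalRing L v))) =
      a₂ • (Matrix.of fun i j : Fin N => if i.val + j.val + 1 = N then (1 : L) else 0).map (algebraMap L (LocalRing L v)))
    (h₃ : formCongr (conjLocal L (IsCMField.complexConj L) v) T₃ (H.map (algebraMap L (LocalRing L v))) =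
      a₃ • (Matrix.of fun i j : Fin N => if i.val + j.val + 1 = N then (1 : L) else 0).map (algebraMap L (LocalRing L v)))
    (c : IrrClass ((cmDatum L N H).Local v)) :
    IrrClass.comap (cmDatumLocalCongr L v T₁ ha₁ h₁) c = IrrClass.comap (cmDatumLocalCongr L v T₂ ha₂ h₂) c ∨
    IrrClass.comap (cmDatumLocalCongr L v T₁ ha₁ h₁) c = IrrClass.comap (cmDatumLocalCongr L v T₃ ha₃ h₃) c ∨
    IrrClass.comap (cmDatumLocalCongr L v T₂ ha₂ h₂) c = IrrClass.comap (cmDatumLocalCongr L v T₃ ha₃ h₃) c := by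
  have hσ₁ := conjLocal_eq_self_of_formCongr_eq_smul_antidiag L hN hH v T₁ h₁
  have hσ₂ := conjLocal_eq_self_of_formCongr_eq_smul_antidiag L hN hH v T₂ h₂
  have hσ₃ := conjLocal_eq_self_of_formCongr_eq_smul_antidiag L hN hH v T₃ h₃
  rcases exists_eq_norm_mul_of_three L v hσ₁ ha₁ hσ₂ ha₂ hσ₃ ha₃ with ⟨z, hz, hzz⟩ | ⟨z, hz, hzz⟩ | ⟨z, hz, hzz⟩
  · exact Or.inl (comap_cmDatumLocalCongr_eq_of_eq_norm_mul L v T₁ T₂ ha₁ ha₂ h₁ h₂ hz hzz c)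
  · exact Or.inr (Or.inl (comap_cmDatumLocalCongr_eq_of_eq_norm_mul L v T₁ T₃ ha₁ ha₃ h₁ h₃ hz hzz c))
  · exact Or.inr (Or.inr (comap_cmDatumLocalCongr_eq_of_eq_norm_mul L v T₂ T₃ ha₂ ha₃ h₂ h₃ hz hzz c))

/-! ## §3 A full similitude orbit in `Irr(U(Φ_N)(L⁺_v))` has one or two members -/

/-- `T = 1` is a similitude of `(Φ_N)_v` with multiplier `1`. [cite: PlatonovRapinchuk1994, §2.3] -/
theorem formCongr_one_antidiag {N : ℕ} (v : HeightOneSpectrum (𝓞 ↥(maximalRealSubfield L))) :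
    formCongr (conjLocal L (IsCMField.complexConj L) v) (1 : GL (Fin N) (LocalRing L v))
      ((Matrix.of fun i j : Fin N => if i.val + j.val + 1 = N then (1 : L) else 0).map (algebraMap L (LocalRing L v))) =
      (1 : LocalRing L v) • (Matrix.of fun i j : Fin N => if i.val + j.val + 1 = N then (1 : L) else 0).map
        (algebraMap L (LocalRing L v)) := by
  rw [formCongr_one_eq, one_smul]

/-- **A similitude orbit has at most two members** (Prop. 11.1.1 (a) «at most two» for `N = 2`): if the finset `O ⊆ Irr(U(Φ_N)(L⁺_v))`
(`N ≠ 0`) consists EXACTLY of the pull-backs `σ ∘ Ad(T)` of one class `σ` along all local similitudes `ᵗσ(T) (Φ_N)_v T = a (Φ_N)_v`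
(`a` a unit), then `O.card ≤ 2` — three members would be three pairwise distinct pull-backs, against §2. [cite: Rogawski1990, §11.1 p. 161,
Prop. 11.1.1 (a)] -/
theorem card_le_two_of_forall_mem_iff {N : ℕ} (hN : N ≠ 0) (v : HeightOneSpectrum (𝓞 ↥(maximalRealSubfield L)))
    (O : Finset (IrrClass ((cmDatum L N (Matrix.of fun i j : Fin N => if i.val + j.val + 1 = N then (1 : L) else 0)).Local v)))
    (σ : IrrClass ((cmDatum L N (Matrix.of fun i j : Fin N => if i.val + j.val + 1 = N then (1 : L) else 0)).Local v))
    (hO : ∀ c, c ∈ O ↔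
      ∃ (T : GL (Fin N) (LocalRing L v)) (a : LocalRing L v) (ha : IsUnit a)
        (h : formCongr (conjLocal L (IsCMField.complexConj L) v) T
          ((Matrix.of fun i j : Fin N => if i.val + j.val + 1 = N then (1 : L) else 0).map (algebraMap L (LocalRing L v))) =
          a • (Matrix.of fun i j : Fin N => if i.val + j.val + 1 = N then (1 : L) else 0).map (algebraMap L (LocalRing L v))),
        c = IrrClass.comap (cmDatumLocalCongr L v T ha h) σ) :
    O.card ≤ 2 := by
  by_contra hlt
  obtain ⟨c₁, c₂, c₃, hc₁, hc₂, hc₃, h₁₂, h₁₃, h₂₃⟩ := Finset.two_lt_card_iff.1 (not_le.1 hlt)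
  obtain ⟨T₁, a₁, ha₁, e₁, rfl⟩ := (hO c₁).1 hc₁
  obtain ⟨T₂, a₂, ha₂, e₂, rfl⟩ := (hO c₂).1 hc₂
  obtain ⟨T₃, a₃, ha₃, e₃, rfl⟩ := (hO c₃).1 hc₃
  rcases exists_comap_eq_of_three L hN (antidiagOne_isHermitian L N) v T₁ T₂ T₃ ha₁ ha₂ ha₃ e₁ e₂ e₃ σ with h | h | h
  · exact h₁₂ h
  · exact h₁₃ h
  · exact h₂₃ h

/-- **A similitude orbit has one or two members** (Prop. 11.1.1 (a) for `N = 2`: «all packets have one or two elements»): under the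
hypothesis of `card_le_two_of_forall_mem_iff` also `σ ∈ O` (`T = 1`, multiplier `1`, and `Ad(1)` fixes every class — ★
`comap_cmDatumLocalCongr_eq_self_of_coe`), so `O.card ∈ {1, 2}`. [cite: Rogawski1990, §11.1 p. 161, Prop. 11.1.1 (a)] -/
theorem card_eq_one_or_two_of_forall_mem_iff {N : ℕ} (hN : N ≠ 0) (v : HeightOneSpectrum (𝓞 ↥(maximalRealSubfield L)))
    (O : Finset (IrrClass ((cmDatum L N (Matrix.of fun i j : Fin N => if i.val + j.val + 1 = N then (1 : L) else 0)).Local v)))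
    (σ : IrrClass ((cmDatum L N (Matrix.of fun i j : Fin N => if i.val + j.val + 1 = N then (1 : L) else 0)).Local v))
    (hO : ∀ c, c ∈ O ↔
      ∃ (T : GL (Fin N) (LocalRing L v)) (a : LocalRing L v) (ha : IsUnit a)
        (h : formCongr (conjLocal L (IsCMField.complexConj L) v) T
          ((Matrix.of fun i j : Fin N => if i.val + j.val + 1 = N then (1 : L) else 0).map (algebraMap L (LocalRing L v))) =
          a • (Matrix.of fun i j : Fin N => if i.val + j.val + 1 = N then (1 : L) else 0).map (algebraMap L (LocalRing L v))),
        c = IrrClass.comap (cmDatumLocalCongr L v T ha h) σ) :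
    O.card = 1 ∨ O.card = 2 := by
  have hle := card_le_two_of_forall_mem_iff L hN v O σ hO
  have hmem : σ ∈ O :=
    (hO σ).2 ⟨1, 1, isUnit_one, formCongr_one_antidiag L v,
      (comap_cmDatumLocalCongr_eq_self_of_coe L v 1 isUnit_one (formCongr_one_antidiag L v) σ).symm⟩
  have hpos : 0 < O.card := Finset.card_pos.2 ⟨σ, hmem⟩
  omega

/-! ## §4 THE SOCKET S4#B4 in NAME-SHAPE: an `H_v`-packet has one or two members -/

/-- **Socket S4#B4 `stub_R90_S4_H_card` (NAME-SHAPE — the by-write file's `HLoc ∕ U2Loc ∕ U1Loc ∕ Φ₂Loc ∕ IsRogPacketH ∕ IsRogPacketU2 ∕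
IsU2SimilConj` unfolded byte for byte): an L-packet `S = O ⊠ χ₁` of `H_v = U(Φ₂)(L⁺_v) × U(Φ₁)(L⁺_v)` — `O` the full similitude orbit of
an admissible class of `U(Φ₂)(L⁺_v)`, `χ₁` a smooth character of `U(Φ₁)(L⁺_v) = E¹_v` — has ONE OR TWO members** (Prop. 11.1.1 (a)
transported by the injective `⊠ χ₁`, ★ `IrrClass.boxChar_injective`; `Finset.card_map`).  The admissibility of the generator is not used
by the count. [cite: Rogawski1990, Prop. 11.1.1 (a) p. 161; §12.1 pp. 171–172; Prop. 13.1.2 (a) p. 198] -/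
theorem card_eq_one_or_two_of_isRogPacketH (v : HeightOneSpectrum (𝓞 ↥(maximalRealSubfield L)))
    (S : Finset (IrrClass
      ((cmDatum L 2 (Matrix.of fun i j : Fin 2 => if i.val + j.val + 1 = 2 then (1 : L) else 0)).Local v ×
        (cmDatum L 1 (Matrix.of fun i j : Fin 1 => if i.val + j.val + 1 = 1 then (1 : L) else 0)).Local v)))
    (hS : ∃ (O : Finset (IrrClass ((cmDatum L 2 (Matrix.of fun i j : Fin 2 => if i.val + j.val + 1 = 2 then (1 : L) else 0)).Local v)))
        (χ : (cmDatum L 1 (Matrix.of fun i j : Fin 1 => if i.val + j.val + 1 = 1 then (1 : L) else 0)).Local v →* ℂˣ)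
        (hχ : IsOpen ((χ.ker : Subgroup
            ((cmDatum L 1 (Matrix.of fun i j : Fin 1 => if i.val + j.val + 1 = 1 then (1 : L) else 0)).Local v)) :
          Set ((cmDatum L 1 (Matrix.of fun i j : Fin 1 => if i.val + j.val + 1 = 1 then (1 : L) else 0)).Local v))),
        (∃ σ : IrrClass ((cmDatum L 2 (Matrix.of fun i j : Fin 2 => if i.val + j.val + 1 = 2 then (1 : L) else 0)).Local v),
          σ.IsAdmissible ∧ ∀ c, c ∈ O ↔
            ∃ (T : GL (Fin 2) (LocalRing L v)) (a : LocalRing L v) (ha : IsUnit a)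
              (h : formCongr (conjLocal L (IsCMField.complexConj L) v) T
                ((Matrix.of fun i j : Fin 2 => if i.val + j.val + 1 = 2 then (1 : L) else 0).map (algebraMap L (LocalRing L v))) =
                a • (Matrix.of fun i j : Fin 2 => if i.val + j.val + 1 = 2 then (1 : L) else 0).map (algebraMap L (LocalRing L v))),
              c = IrrClass.comap (cmDatumLocalCongr L v T ha h) σ) ∧
        S = O.map ⟨IrrClass.boxChar χ hχ, IrrClass.boxChar_injective χ hχ⟩) :
    S.card = 1 ∨ S.card = 2 := by
  obtain ⟨O, χ, hχ, ⟨σ, -, hO⟩, rfl⟩ := hS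
  rw [Finset.card_map]
  exact card_eq_one_or_two_of_forall_mem_iff L two_ne_zero v O σ hO

end Summit.HodgeConjecture.HodgeConjecture.R90.S4

end
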